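import Summits.Ventures.LatticeQCDFlow.Scaling.SimulatedTemperingAcceptance
import Summits.Ventures.LatticeQCDFlow.Scaling.SwapAcceptanceKernel

/-!
HONEST FRAMING: exact (Metropolis-corrected) sampling algorithms for lattice gauge theory; figures
of merit are autocorrelation/cost numbers at stated couplings and volumes; no continuum-physics
claim.

# LeCamSwapFloor — LE CAM'S INEQUALITY AT MEASURE LEVEL AND THE GAUSSIAN-SHAPED FLOORS: OVERLAP AND
# SIMULATED-TEMPERING ACCEPTANCE `≥ ½·BC² ≥ ½·exp(−M(t−s)²/4)`, REPLICA-EXCHANGE SWAP ACCEPTANCE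
# `≥ ½·BC⁴ ≥ ½·exp(−M(t−s)²/2)` UNDER A VARIANCE CEILING `M` — SO `½e^{−Mδ²/2} ≤ swapAcc ≤ e^{−mδ²/4}`,
# EVERY COMPACT GAUGE GROUP (lean-2 GEN-11, ours)

Venture-side (OURS).  Cell `lqcd-flow` (pub-lqcd), unit `pub-lqcd-lean-2-g11`, 2026-08-23.  The Jensen floors
of `SwapAcceptanceLaw` / `CouplingOverlap` (`exp(−(δ√M + Mδ²))`) are sharp near `δ = 0` but not Gaussian in
shape; Le Cam's inequality `(∫√(fg))² ≤ (∫min(f,g))·(∫max(f,g)) = o(2 − o)` (Cauchy–Schwarz on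
`√(fg) = √min·√max`) gives `∫ min(f,g) ≥ ½(∫√(fg))²` for any two bounded probability densities, and the
Bhattacharyya coefficient of an exponential family is exact (`CouplingOverlap.integral_sqrt_tiltedDensity_mul`):

* §1 `half_bhatt_sq_le_overlap` (abstract Le Cam, any finite reference measure).
* §2 exponential family `μ_u = μ.tilted(u·X)`: `overlap_ge_half_exp` (`∫min(p_s,p_t) ≥ ½exp(−(ψ(s)+ψ(t)−2ψ(m)))`),
  **`overlap_ge_half_exp_neg_ceiling`** (`≥ ½exp(−M(t−s)²/4)`), the same for the simulated-tempering
  level move (`stAcc_ge_half_exp_neg_ceiling`); and for the SWAP: `swapAcc_eq_overlap_pair` — `swapAcc` is the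
  overlap of the pair measure `μ_s ⊗ μ_t` with its swapped image (densities `p_s(x)p_t(y)` and `p_t(x)p_s(y)`
  over `μ ⊗ μ`), whose Bhattacharyya coefficient is `BC(μ_s,μ_t)²`, hence **`swapAcc ≥ ½exp(−2(ψ(s)+ψ(t)−2ψ(m)))
  ≥ ½exp(−M(t−s)²/2)`** (`swapAcc_ge_half_exp`, `swapAcc_ge_half_exp_neg_ceiling`).  With
  `SwapAcceptanceLadder.swapAcc_le_exp_neg_floor`: **`½e^{−Mδ²/2} ≤ swapAcc ≤ e^{−mδ²/4}`**.
* §3 Wilson, every compact `G`: `wilson_swapAcc_ge_half_of_ceiling`; **`wilson_swapAcc_ge_half_strongCoupling`**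
  (`[a,b] ⊆ [−r/4, r/4]`: `swapAcc ≥ ½exp(−16#plaq(b−a)²/r²)`); `wilson_swapAcc_ge_half_allCouplings` (trivial
  ceiling: `≥ ½exp(−(N#plaq)²(b−a)²/2)`).

Literature grade (cell rule): KNOWN MECHANISM (Le Cam 1973 / the tree's finite `Theory2.bhatt_sq_le`), NEW
TYPING at measure level; nothing cited as a fact.  NOT CLAIMED: sharp constants; finite samples.
-/

noncomputable section

open MeasureTheory ProbabilityTheory Real Set
open Literature.MathematicalPhysics.QuantumFieldTheory
open Literature.MathematicalPhysics.QuantumFieldTheory.Luscher2010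
open Summit.Ventures.LatticeQCDFlow.TrivializingMaps
open scoped Matrix Matrix.Norms.Frobenius ContDiff

namespace Summit.Ventures.LatticeQCDFlow.Scaling

/-! ## §1 Le Cam's inequality for two bounded probability densities -/

section LeCam

variable {α : Type*} [MeasurableSpace α] {ν : Measure α} [IsFiniteMeasure ν]

/-- **LE CAM (measure level): `½(∫√(fg) dν)² ≤ ∫ min(f,g) dν`** for measurable bounded densities
`f, g ≥ 0` with `∫f = ∫g = 1` (Cauchy–Schwarz on `√(fg) = √min·√max` and `∫max = 2 − ∫min`). [folklore] -/
theorem half_bhatt_sq_le_overlap {f g : α → ℝ} (hf : Measurable f) (hg : Measurable g)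
    (hf0 : ∀ x, 0 ≤ f x) (hg0 : ∀ x, 0 ≤ g x) (hfb : ∃ C, ∀ x, f x ≤ C) (hgb : ∃ C, ∀ x, g x ≤ C)
    (hf1 : ∫ x, f x ∂ν = 1) (hg1 : ∫ x, g x ∂ν = 1) :
    (∫ x, sqrt (f x * g x) ∂ν) ^ 2 / 2 ≤ ∫ x, min (f x) (g x) ∂ν := by
  obtain ⟨Cf, hCf⟩ := hfb
  obtain ⟨Cg, hCg⟩ := hgb
  have hfi : Integrable f ν := integrable_of_abs_le hf (C := Cf) fun x => by
    rw [abs_of_nonneg (hf0 x)]; exact hCf x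
  have hgi : Integrable g ν := integrable_of_abs_le hg (C := Cg) fun x => by
    rw [abs_of_nonneg (hg0 x)]; exact hCg x
  have hmn0 : ∀ x, 0 ≤ min (f x) (g x) := fun x => le_min (hf0 x) (hg0 x)
  have hmx0 : ∀ x, 0 ≤ max (f x) (g x) := fun x => (hf0 x).trans (le_max_left _ _)
  have hmni : Integrable (fun x => min (f x) (g x)) ν := hfi.inf hgi
  have hmxi : Integrable (fun x => max (f x) (g x)) ν := hfi.sup hgi
  -- `∫ max = 2 − ∫ min`
  have hsum : ∫ x, min (f x) (g x) ∂ν + ∫ x, max (f x) (g x) ∂ν = 2 := by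
    rw [← integral_add hmni hmxi]
    have : (fun x => min (f x) (g x) + max (f x) (g x)) = fun x => f x + g x :=
      funext fun x => min_add_max _ _
    rw [this, integral_add hfi hgi, hf1, hg1]; norm_num
  -- Cauchy–Schwarz: `∫ √min √max ≤ √(∫min) √(∫max)`
  have hsm : MemLp (fun x => sqrt (min (f x) (g x))) (ENNReal.ofReal 2) ν :=
    memLp_of_bounded (a := 0) (b := sqrt Cf)
      (ae_of_all _ fun x => ⟨sqrt_nonneg _, sqrt_le_sqrt ((min_le_left _ _).trans (hCf x))⟩)
      (hf.min hg).sqrt.aestronglyMeasurable _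
  have hsM : MemLp (fun x => sqrt (max (f x) (g x))) (ENNReal.ofReal 2) ν :=
    memLp_of_bounded (a := 0) (b := sqrt (max Cf Cg))
      (ae_of_all _ fun x => ⟨sqrt_nonneg _, sqrt_le_sqrt (max_le_max (hCf x) (hCg x))⟩)
      (hf.max hg).sqrt.aestronglyMeasurable _
  have hCS := integral_mul_le_Lp_mul_Lq_of_nonneg Real.HolderConjugate.two_two
    (ae_of_all _ fun x => sqrt_nonneg (min (f x) (g x)))
    (ae_of_all _ fun x => sqrt_nonneg (max (f x) (g x))) hsm hsM
  have hB : ∫ x, sqrt (f x * g x) ∂ν = ∫ x, sqrt (min (f x) (g x)) * sqrt (max (f x) (g x)) ∂ν := by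
    refine integral_congr_ae (ae_of_all _ fun x => ?_)
    show sqrt (f x * g x) = sqrt (min (f x) (g x)) * sqrt (max (f x) (g x))
    rw [← sqrt_mul (hmn0 x), min_mul_max]
  have h1 : ∫ a, sqrt (min (f a) (g a)) ^ (2 : ℝ) ∂ν = ∫ a, min (f a) (g a) ∂ν :=
    integral_congr_ae (ae_of_all _ fun a => by
      show sqrt (min (f a) (g a)) ^ (2 : ℝ) = min (f a) (g a)
      rw [rpow_two, sq_sqrt (hmn0 a)])
  have h2 : ∫ a, sqrt (max (f a) (g a)) ^ (2 : ℝ) ∂ν = ∫ a, max (f a) (g a) ∂ν :=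
    integral_congr_ae (ae_of_all _ fun a => by
      show sqrt (max (f a) (g a)) ^ (2 : ℝ) = max (f a) (g a)
      rw [rpow_two, sq_sqrt (hmx0 a)])
  rw [h1, h2, ← sqrt_eq_rpow, ← sqrt_eq_rpow] at hCS
  set o := ∫ x, min (f x) (g x) ∂ν with ho
  set O := ∫ x, max (f x) (g x) ∂ν with hO
  have ho0 : 0 ≤ o := integral_nonneg hmn0
  have hO0 : 0 ≤ O := integral_nonneg hmx0
  have hB0 : 0 ≤ ∫ x, sqrt (f x * g x) ∂ν := integral_nonneg fun x => sqrt_nonneg _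
  rw [hB] at hB0 ⊢
  -- `B² ≤ o·O = o(2 − o) ≤ 2o`
  have hB2 : (∫ x, sqrt (min (f x) (g x)) * sqrt (max (f x) (g x)) ∂ν) ^ 2 ≤ o * O := by
    calc (∫ x, sqrt (min (f x) (g x)) * sqrt (max (f x) (g x)) ∂ν) ^ 2 ≤ (sqrt o * sqrt O) ^ 2 :=
          pow_le_pow_left₀ hB0 hCS 2
      _ = o * O := by rw [mul_pow, sq_sqrt ho0, sq_sqrt hO0]
  have hO2 : O = 2 - o := by linarith
  rw [hO2] at hB2
  nlinarith

end LeCam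

/-! ## §2 The exponential family: Gaussian-shaped floors for overlap, level moves and swaps -/

section Family

variable {Ω : Type*} [MeasurableSpace Ω] {μ : Measure Ω} [IsProbabilityMeasure μ] {X : Ω → ℝ}

/-- `p_u` is bounded above. [folklore] -/
theorem tiltedDensity_le (hXm : Measurable X) {B : ℝ} (hB : ∀ x, |X x| ≤ B) (u : ℝ) (x : Ω) :
    exp (u * X x) / mgf X μ u ≤ exp (|u| * B) / mgf X μ u := by
  refine div_le_div_of_nonneg_right (exp_le_exp.2 ?_) (mgf_pos_of_bounded hXm ⟨B, hB⟩ u).le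
  calc u * X x ≤ |u * X x| := le_abs_self _
    _ = |u| * |X x| := abs_mul _ _
    _ ≤ |u| * B := mul_le_mul_of_nonneg_left (hB x) (abs_nonneg _)

/-- **OVERLAP ≥ ½·BC²**: `∫ min(p_s,p_t) dμ ≥ ½·exp(−(ψ(s) + ψ(t) − 2ψ((s+t)/2)))`. [ours] -/
theorem overlap_ge_half_exp (hXm : Measurable X) (hXb : ∃ C, ∀ x, |X x| ≤ C) (s t : ℝ) :
    exp (-(cgf X μ s + cgf X μ t - 2 * cgf X μ ((s + t) / 2))) / 2 ≤
      ∫ x, min (exp (s * X x) / mgf X μ s) (exp (t * X x) / mgf X μ t) ∂μ := by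
  obtain ⟨B, hB⟩ := hXb
  have hXb : ∃ C, ∀ x, |X x| ≤ C := ⟨B, hB⟩
  have h := half_bhatt_sq_le_overlap (ν := μ) (f := fun x => exp (s * X x) / mgf X μ s)
    (g := fun x => exp (t * X x) / mgf X μ t)
    (((measurable_const.mul hXm).exp).div_const _) (((measurable_const.mul hXm).exp).div_const _)
    (fun x => div_nonneg (exp_pos _).le (mgf_pos_of_bounded hXm hXb s).le)
    (fun x => div_nonneg (exp_pos _).le (mgf_pos_of_bounded hXm hXb t).le)
    ⟨_, tiltedDensity_le hXm hB s⟩ ⟨_, tiltedDensity_le hXm hB t⟩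
    (integral_tiltedDensity_eq_one hXm hXb s) (integral_tiltedDensity_eq_one hXm hXb t)
  rw [integral_sqrt_tiltedDensity_mul hXm hXb s t, ← exp_nat_mul] at h
  refine le_trans (le_of_eq ?_) h
  congr 2
  push_cast
  ring

/-- **OVERLAP UNDER A VARIANCE CEILING, Gaussian shape**: `s ≤ t`, `Var_{μ_u}(X) ≤ M` on `[s,t]` ⇒
`∫ min(p_s,p_t) dμ ≥ ½·exp(−M(t−s)²/4)`. [ours] -/
theorem overlap_ge_half_exp_neg_ceiling (hXm : Measurable X) (hXb : ∃ C, ∀ x, |X x| ≤ C) {s t M : ℝ}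
    (hst : s ≤ t) (hM : ∀ u ∈ Icc s t, variance X (μ.tilted fun x => u * X x) ≤ M) :
    exp (-(M * (t - s) ^ 2 / 4)) / 2 ≤
      ∫ x, min (exp (s * X x) / mgf X μ s) (exp (t * X x) / mgf X μ t) ∂μ := by
  refine le_trans (div_le_div_of_nonneg_right (exp_le_exp.2 ?_) zero_le_two)
    (overlap_ge_half_exp hXm hXb s t)
  have h := midpoint_gap_le_of_deriv2_le (hasDerivAt_cgf_of_bounded (μ := μ) hXm hXb)
    (hasDerivAt_deriv_cgf_of_bounded (μ := μ) hXm hXb) hst hM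
  linarith

/-- **Simulated-tempering level move, Gaussian floor**: `∫ min(1, p_t/p_s) dμ_s ≥ ½·exp(−M(t−s)²/4)`. [ours] -/
theorem stAcc_ge_half_exp_neg_ceiling (hXm : Measurable X) (hXb : ∃ C, ∀ x, |X x| ≤ C) {s t M : ℝ}
    (hst : s ≤ t) (hM : ∀ u ∈ Icc s t, variance X (μ.tilted fun x => u * X x) ≤ M) :
    exp (-(M * (t - s) ^ 2 / 4)) / 2 ≤
      ∫ x, min 1 ((exp (t * X x) / mgf X μ t) / (exp (s * X x) / mgf X μ s)) ∂(μ.tilted fun x => s * X x) := by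
  rw [stAcc_eq_overlap hXm hXb s t]
  exact overlap_ge_half_exp_neg_ceiling hXm hXb hst hM

/-- **THE SWAP ACCEPTANCE IS THE OVERLAP OF THE PAIR MEASURE WITH ITS SWAPPED IMAGE**:
`swapAcc X μ s t = ∫ min(p_s(x)p_t(y), p_t(x)p_s(y)) d(μ⊗μ)`. [ours] -/
theorem swapAcc_eq_overlap_pair (hXm : Measurable X) (hXb : ∃ C, ∀ x, |X x| ≤ C) (s t : ℝ) :
    swapAcc X μ s t = ∫ z, min (exp (s * X z.1) / mgf X μ s * (exp (t * X z.2) / mgf X μ t))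
      (exp (t * X z.1) / mgf X μ t * (exp (s * X z.2) / mgf X μ s)) ∂(μ.prod μ) := by
  have hZs : 0 < mgf X μ s := mgf_pos_of_bounded hXm hXb s
  have hZt : 0 < mgf X μ t := mgf_pos_of_bounded hXm hXb t
  unfold swapAcc
  rw [tilted_prod_tilted_mul hXm s t, integral_tilted]
  have hZ : ∫ z, exp (s * X z.1 + t * X z.2) ∂(μ.prod μ) = mgf X μ s * mgf X μ t := by
    simp_rw [exp_add]
    exact integral_prod_mul (fun x => exp (s * X x)) (fun y => exp (t * X y))
  refine integral_congr_ae (ae_of_all _ fun z => ?_)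
  have hF : 0 ≤ exp (s * X z.1 + t * X z.2) / (mgf X μ s * mgf X μ t) :=
    div_nonneg (exp_pos _).le (mul_pos hZs hZt).le
  simp only [hZ, smul_eq_mul]
  rw [mul_min_of_nonneg _ _ hF, mul_one]
  congr 1
  · rw [exp_add]; field_simp
  · have key : exp (s * X z.1 + t * X z.2) * exp ((t - s) * (X z.1 - X z.2)) =
        exp (t * X z.1) * exp (s * X z.2) := by
      rw [← exp_add, ← exp_add]; congr 1; ring
    rw [div_mul_eq_mul_div, key]
    field_simp

/-- **SWAP ACCEPTANCE ≥ ½·BC⁴**: `swapAcc ≥ ½·exp(−2(ψ(s) + ψ(t) − 2ψ((s+t)/2)))` (Le Cam on the pair densities,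
whose Bhattacharyya coefficient is `BC(μ_s,μ_t)²` by Fubini). [ours] -/
theorem swapAcc_ge_half_exp (hXm : Measurable X) (hXb : ∃ C, ∀ x, |X x| ≤ C) (s t : ℝ) :
    exp (-(2 * (cgf X μ s + cgf X μ t - 2 * cgf X μ ((s + t) / 2)))) / 2 ≤ swapAcc X μ s t := by
  obtain ⟨B, hB⟩ := hXb
  have hXb : ∃ C, ∀ x, |X x| ≤ C := ⟨B, hB⟩
  have hZ : ∀ u, 0 < mgf X μ u := fun u => mgf_pos_of_bounded hXm hXb u
  have hpm : ∀ u, Measurable fun x => exp (u * X x) / mgf X μ u := fun u =>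
    ((measurable_const.mul hXm).exp).div_const _
  have hp0 : ∀ u x, 0 ≤ exp (u * X x) / mgf X μ u := fun u x => div_nonneg (exp_pos _).le (hZ u).le
  have hpb := fun u => tiltedDensity_le (μ := μ) hXm hB u
  -- the two pair densities
  have hFm : Measurable fun z : Ω × Ω => exp (s * X z.1) / mgf X μ s * (exp (t * X z.2) / mgf X μ t) :=
    ((hpm s).comp measurable_fst).mul ((hpm t).comp measurable_snd)
  have hGm : Measurable fun z : Ω × Ω => exp (t * X z.1) / mgf X μ t * (exp (s * X z.2) / mgf X μ s) :=
    ((hpm t).comp measurable_fst).mul ((hpm s).comp measurable_snd)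
  have hF1 : ∫ z, exp (s * X z.1) / mgf X μ s * (exp (t * X z.2) / mgf X μ t) ∂(μ.prod μ) = 1 := by
    rw [integral_prod_mul (fun x => exp (s * X x) / mgf X μ s) (fun y => exp (t * X y) / mgf X μ t),
      integral_tiltedDensity_eq_one hXm hXb s, integral_tiltedDensity_eq_one hXm hXb t, mul_one]
  have hG1 : ∫ z, exp (t * X z.1) / mgf X μ t * (exp (s * X z.2) / mgf X μ s) ∂(μ.prod μ) = 1 := by
    rw [integral_prod_mul (fun x => exp (t * X x) / mgf X μ t) (fun y => exp (s * X y) / mgf X μ s),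
      integral_tiltedDensity_eq_one hXm hXb s, integral_tiltedDensity_eq_one hXm hXb t, mul_one]
  have h := half_bhatt_sq_le_overlap (ν := μ.prod μ) hFm hGm
    (fun z => mul_nonneg (hp0 s _) (hp0 t _)) (fun z => mul_nonneg (hp0 t _) (hp0 s _))
    ⟨_, fun z => mul_le_mul (hpb s z.1) (hpb t z.2) (hp0 t _) (div_nonneg (exp_pos _).le (hZ s).le)⟩
    ⟨_, fun z => mul_le_mul (hpb t z.1) (hpb s z.2) (hp0 s _) (div_nonneg (exp_pos _).le (hZ t).le)⟩
    hF1 hG1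
  rw [swapAcc_eq_overlap_pair hXm hXb s t]
  refine le_trans (le_of_eq ?_) h
  -- the Bhattacharyya coefficient of the pair densities is `BC(s,t)²`
  have hsq : ∀ z : Ω × Ω, sqrt (exp (s * X z.1) / mgf X μ s * (exp (t * X z.2) / mgf X μ t) *
      (exp (t * X z.1) / mgf X μ t * (exp (s * X z.2) / mgf X μ s))) =
      sqrt (exp (s * X z.1) / mgf X μ s * (exp (t * X z.1) / mgf X μ t)) *
        sqrt (exp (s * X z.2) / mgf X μ s * (exp (t * X z.2) / mgf X μ t)) := by
    intro z
    rw [← sqrt_mul (mul_nonneg (hp0 s _) (hp0 t _))]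
    congr 1; ring
  simp_rw [hsq]
  rw [integral_prod_mul (fun x => sqrt (exp (s * X x) / mgf X μ s * (exp (t * X x) / mgf X μ t)))
      (fun y => sqrt (exp (s * X y) / mgf X μ s * (exp (t * X y) / mgf X μ t))),
    integral_sqrt_tiltedDensity_mul hXm hXb s t, ← exp_add, ← exp_nat_mul]
  congr 2
  push_cast
  ring

/-- **SWAP ACCEPTANCE UNDER A VARIANCE CEILING, Gaussian shape**: `s ≤ t`, `Var_{μ_u}(X) ≤ M` on `[s,t]` ⇒
`swapAcc ≥ ½·exp(−M(t−s)²/2)` — with `swapAcc_le_exp_neg_floor`: `½e^{−Mδ²/2} ≤ swapAcc ≤ e^{−mδ²/4}`. [ours] -/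
theorem swapAcc_ge_half_exp_neg_ceiling (hXm : Measurable X) (hXb : ∃ C, ∀ x, |X x| ≤ C) {s t M : ℝ}
    (hst : s ≤ t) (hM : ∀ u ∈ Icc s t, variance X (μ.tilted fun x => u * X x) ≤ M) :
    exp (-(M * (t - s) ^ 2 / 2)) / 2 ≤ swapAcc X μ s t := by
  refine le_trans (div_le_div_of_nonneg_right (exp_le_exp.2 ?_) zero_le_two)
    (swapAcc_ge_half_exp hXm hXb s t)
  have h := midpoint_gap_le_of_deriv2_le (hasDerivAt_cgf_of_bounded (μ := μ) hXm hXb)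
    (hasDerivAt_deriv_cgf_of_bounded (μ := μ) hXm hXb) hst hM
  linarith

end Family

/-! ## §3 The Wilson coupling family, every compact gauge group -/

section Wilson

variable {d L N : ℕ} [NeZero L] {G : Type*} [Group G] [TopologicalSpace G] [IsTopologicalGroup G]
  [CompactSpace G] [MeasurableSpace G] [BorelSpace G] [SecondCountableTopology G]
  (ρ : G →* Matrix (Fin N) (Fin N) ℂ)

/-- **Gaussian swap floor for Wilson couplings under a specific-heat ceiling** (`a ≤ b`, `Var_u(S_W) ≤ M` on
`[a,b]`): `swapAcc ≥ ½·exp(−M(b−a)²/2)`. [ours] -/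
theorem wilson_swapAcc_ge_half_of_ceiling (hρ : Continuous ρ) {a b M : ℝ} (hab : a ≤ b)
    (hM : ∀ u ∈ Icc a b, variance (wilsonAction (d := d) (L := L) ρ) (wilsonMeasure (d := d) (L := L) ρ u) ≤ M) :
    exp (-(M * (b - a) ^ 2 / 2)) / 2 ≤ swapAcc (fun U => -wilsonAction ρ U) (trivialMeasure G d L) a b := by
  haveI : IsProbabilityMeasure (trivialMeasure G d L) := trivialMeasure_isProbabilityMeasure
  refine swapAcc_ge_half_exp_neg_ceiling (μ := trivialMeasure G d L) (measurable_neg_wilsonAction ρ hρ)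
    (neg_wilsonAction_bounded ρ hρ) hab fun u hu => ?_
  have h := hM u hu
  rwa [← tilted_neg_wilsonAction_eq ρ hρ u, ← variance_fun_neg] at h

/-- **Strong coupling, every compact gauge group** (`[a,b] ⊆ [−r/4, r/4]`, ceiling `32#plaq/r²`):
`swapAcc ≥ ½·exp(−16·#plaq·(b−a)²/r²)` — `O(1)` swap rates for `b − a = O(r/√#plaq)`. [ours] -/
theorem wilson_swapAcc_ge_half_strongCoupling (hρ : Continuous ρ)
    (hρu : ∀ g, ρ g ∈ Matrix.unitaryGroup (Fin N) ℂ) {a b : ℝ} (hab : a ≤ b)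
    (hlo : -(1 / (4 * Real.exp 1 * max 1 (2 * (N : ℝ)) * ((3 : ℝ) ^ d * (d : ℝ) ^ 2 + 1) ^ 2) / 4) ≤ a)
    (hhi : b ≤ 1 / (4 * Real.exp 1 * max 1 (2 * (N : ℝ)) * ((3 : ℝ) ^ d * (d : ℝ) ^ 2 + 1) ^ 2) / 4) :
    exp (-(32 * Fintype.card (Plaquette d L) /
        (1 / (4 * Real.exp 1 * max 1 (2 * (N : ℝ)) * ((3 : ℝ) ^ d * (d : ℝ) ^ 2 + 1) ^ 2)) ^ 2 *
          (b - a) ^ 2 / 2)) / 2 ≤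
      swapAcc (fun U => -wilsonAction ρ U) (trivialMeasure G d L) a b := by
  have hr0 := kpRadiusGroup_pos d N
  refine wilson_swapAcc_ge_half_of_ceiling (d := d) (L := L) ρ hρ hab fun u hu => ?_
  refine wilson_variance_le_anyGroup (d := d) (L := L) ρ hρ hρu u ?_
  rw [abs_lt]
  exact ⟨by linarith [hu.1], by linarith [hu.2]⟩

/-- **Every coupling, every compact `G`** (trivial ceiling `(N#plaq)²`):
`swapAcc ≥ ½·exp(−(N#plaq)²(b−a)²/2)`. [ours] -/
theorem wilson_swapAcc_ge_half_allCouplings (hρ : Continuous ρ) {a b : ℝ} (hab : a ≤ b) :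
    exp (-(((N : ℝ) * Fintype.card (Plaquette d L)) ^ 2 * (b - a) ^ 2 / 2)) / 2 ≤
      swapAcc (fun U => -wilsonAction ρ U) (trivialMeasure G d L) a b :=
  wilson_swapAcc_ge_half_of_ceiling (d := d) (L := L) ρ hρ hab fun u _ => wilson_variance_le_sq ρ hρ u

end Wilson

end Summit.Ventures.LatticeQCDFlow.Scaling

end
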